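/-
Copyright (c) 2026 the pub-hodgecm-mathlib formalisation cell (harness21).  Prover seat hodgecm-mathlib-K2Liu-p03 (g6): Track B «K2-LIT»,
#184♮ = hLiu418 = stmt-HodgeConjecture-24832, road `K2_Liu`, Road I organ (A-int)-fin, A7-reg (GK COCYCLE road), file B1b-1
(RULING M-156m′ (4); heads `K2/K2Liu-p03/g6/HEADS-B1-BorelFrame.K2Liu-p03-g6.md` §1 B1b).
-/
import Summits.HodgeConjecture.HodgeConjecture.Theorems.K2LiuDoubledUTwoTwoWeylCocycle   -- ★ B1a-2 (⇒ B1a-1): letters of `U(J₄)`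
import Summits.HodgeConjecture.HodgeConjecture.Theorems.K2LiuLocalSiegelIwasawa          -- ★ frame `Q`, `frameConj`, `antidiagonal_over_eq_map`, `reindex_mul_reindex`
import Literature.NumberTheory.K2Lit.LocalSiegelIntertwining                             -- ★ D10 `unipDeltaLocal`, `weylDelta`
import HarnessLib

/-!
# Crux `HLiu418`, road `K2_Liu`, organ (A-int)-fin, A7-reg file B1b-1: TRANSPORT OF THE `U(J₄)` LETTERS TO THE DOUBLED GROUP `H_v`
# along the rational frame `Q = e₂ ∘ (1 D; 1 −D)` — the adapted-frame formula, the Siegel unipotent ONTO `N_Δ`, and `Q w_Δ^{J} Q⁻¹ = w_Δ · m₀`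

Cell `hodgecm-mathlib`, crux item hLiu418 = `stmt-HodgeConjecture-24832`; squad K2 ∕ K2Liu; prover K2Liu-p03 (g6).  ONE definition (`toLocalFour`, the
identification of B1a's abstract `U(J₄)(R, σ)` at `R := E ⊗ F_v` with the tree's factor-form `U(J₄)(F_v)`) + theorems; review lane
`--kind definition --supports stmt-HodgeConjecture-24832 --as helper`; no instance, no notation, no named-fact hypothesis, no `sorry`.

SETTING (★ D10 ∕ ★ `K2LiuLocalSiegelIwasawa`): `E/F` quadratic with `c`, a finite place `v` of `F`, `H_v = U(T₀ ⊕ −T₀)(F_v)` the doubled group on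
`UnitaryGroup.localPi E c (n+n) JD v` (`hJD : JD = (gramD F n T₀) ⊗ E`), its `Δ`-adapted frame `adapt ∘ matA` (`P_Δ = {C = 0}`, `N_Δ = {(1 t; 0 1)}`, ★ `weylDelta`
with adapted matrix `(0 1; 1 0)`), and a RATIONAL FRAME `Q ∈ GL_{2n}(F)` with `Qᵀ (T₀ ⊕ −T₀) Q = J_{2n}` of the shape `Q = e₂ ∘ (1 D; 1 −D)` (at a good place
`D = ½ T₀⁻¹ W`; here `D` is any matrix with a two-sided inverse `Dinv`), and ★ `frameConj Q : U(J_{2n})(F_v) ≃ₜ* H_v`, `g′ ↦ Q g′ Q⁻¹`.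
* §1 (generic `n`) **`adapt_matA_frameConj`**: in the `Δ`-ADAPTED frame the transport is conjugation by `diag(1, D)`:
  `adapt (matA (frameConj Q g′)) = diag(1, D_v) · M′ · diag(1, Dinv_v)`, `M′` = the `Fin n ⊕ Fin n`-blocked matrix of `g′` over `E ⊗ F_v`
  (the computation inside ★ `blkC_frame_conj_eq_zero`, promoted to an identity).
* §2 (`n = 2`) **`toLocalFour`**: `U(J₄)(E ⊗ F_v, conjLocal)` (B1a's carrier) `≃ₜ* UnitaryGroup.localPi E c 4 (J₄ ⊗ E) v` and its matrix lemma.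
* §3 THE SIEGEL UNIPOTENT: `adapt (matA (frameConj Q (n(x,z,y)))) = (1, X·Dinv_v; 0, 1)`, `X = (z y; x −σz)` ⇒ **`frameConj_nSiegel_mem_unipDeltaLocal`**.
* §4 THE WEYL ELEMENT: `adapt (matA (weylDelta · frameConj Q (w_Δ^{J}))) = diag(D_v, Dinv_v)` ⇒ **`Q w_Δ^{J} Q⁻¹ = w_Δ · m₀` with `m₀ ∈ M_Δ(F_v)`**
  (`isSiegelDelta_weylDelta_mul_frameConj_weylSiegel`, `blkB_… = 0`): the representative mismatch is a RATIONAL LEVI element sitting to the RIGHT of `w_Δ`,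
  absorbed into the argument of the intertwining integral (no modulus character; file B4 `K2LiuSiegelIntertwiningCocycle`, K2Liu-p09).
HONEST LABEL.  Carriers only, count-neutral: `HC_CM` is proved only modulo the 7 printed citations (2 remaining named inputs: hLiu418 = `stmt-HodgeConjecture-24832`,
h413 = `stmt-HodgeConjecture-24833`) until rung 0 closes.

## References
* [HarrisKudlaSweet1996] M. Harris, S. Kudla, W. J. Sweet, J. AMS 9 (1996): §1 (1.11)–(1.12) (`P_Δ`, `w_Δ`, the frame of the doubled space).
* [PlatonovRapinchuk1994] V. Platonov, A. Rapinchuk, *Algebraic Groups and Number Theory* (1994): §2.3, §5.1 (change of frame, local points).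
* [Casselman1980] W. Casselman, Compositio Math. 40 (1980): §3.
-/

set_option autoImplicit false
set_option linter.dupNamespace false -- the mandated namespace repeats `HodgeConjecture.HodgeConjecture`

noncomputable section

open NumberField IsDedekindDomain Matrix
open Literature.NumberTheory.Automorphic Literature.NumberTheory.Automorphic.UnitaryGroup
open Literature.NumberTheory.GelbartRogawski1991.AdaptedBlocks
open Literature.NumberTheory.GelbartRogawski1991.UnitaryDualPair.LocalSplitting
open Literature.NumberTheory.K2Lit.LocalSiegelDoubled
open Summit.HodgeConjecture.HodgeConjecture.Cruxes.HLiu418.K2LiuLocalSiegelIwasawaFrame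
open Summit.HodgeConjecture.HodgeConjecture.Cruxes.HLiu418.K2LiuLocalSiegelIwasawa
open Summit.HodgeConjecture.HodgeConjecture.Cruxes.HLiu418.K2LiuDoubledUTwoTwoBorelFrame
open Summit.HodgeConjecture.HodgeConjecture.Cruxes.HLiu418.K2LiuDoubledUTwoTwoWeylCocycle

namespace Summit.HodgeConjecture.HodgeConjecture.Cruxes.HLiu418.K2LiuDoubledUTwoTwoFrameTransport

variable (F : Type) [Field F] [NumberField F] (E : Type) [Field E] [NumberField E] [Algebra F E]
  [Algebra.IsQuadraticExtension F E] (c : E ≃ₐ[F] E)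
  {δ : E} (hcδ : c δ = -δ) (hδ : δ ≠ 0) {d : F} (hd : δ * δ = algebraMap F E d)
  (v : HeightOneSpectrum (𝓞 F)) (n : ℕ) {T₀ : Matrix (Fin n) (Fin n) F} (hT₀ : T₀.IsSymm)
  {JD : Matrix (Fin (n + n)) (Fin (n + n)) E} (hJD : JD = (gramD F n T₀).map (algebraMap F E))

/-! ## §1 The transport in the adapted frame: conjugation by `diag(1, D)` -/

section Generic

variable (D Dinv : Matrix (Fin n) (Fin n) F) (hDD : D * Dinv = 1) (Q : GL (Fin (n + n)) F)
  (hQm : (Q : Matrix (Fin (n + n)) (Fin (n + n)) F) = Matrix.reindex (e₂ n) (e₂ n) (Matrix.fromBlocks 1 D 1 (-D)))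
  (hQ : (Q : Matrix (Fin (n + n)) (Fin (n + n)) F)ᵀ * gramD F n T₀ * (Q : Matrix (Fin (n + n)) (Fin (n + n)) F) =
    (StdForm.antidiagonal (n + n)).over F)

omit [Algebra.IsQuadraticExtension F E] in
include hJD in
/-- **matrix of the transport**: `matS (frameConj Q g′) = Q_v · matS g′ · Q_v⁻¹` over `E ⊗ F_v` (★ `coe_frameConjLocal`). [cite: PlatonovRapinchuk1994, §2.3] -/
theorem matS_frameConj (x' : UnitaryGroup.localPi E c (n + n) ((StdForm.antidiagonal (n + n)).over E) v) :
    matS F E c v n (FrameTransport.frameConj F E c v (n + n) hJD (antidiagonal_over_eq_map F E n) Q hQ x') =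
      (Q : Matrix (Fin (n + n)) (Fin (n + n)) F).map ((UnitaryGroup.toLocalRing E v).comp (algebraMap F (v.adicCompletion F))) *
        matS F E c v n x' *
        ((Q⁻¹ : GL (Fin (n + n)) F) : Matrix (Fin (n + n)) (Fin (n + n)) F).map
          ((UnitaryGroup.toLocalRing E v).comp (algebraMap F (v.adicCompletion F))) := by
  have hGL : (UnitaryGroup.localPiEquiv E c (n + n) JD v
        (FrameTransport.frameConj F E c v (n + n) hJD (antidiagonal_over_eq_map F E n) Q hQ x')).1 =
      FrameTransport.framePloc F E v (n + n) Q * (UnitaryGroup.localPiEquiv E c (n + n) _ v x').1 *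
        (FrameTransport.framePloc F E v (n + n) Q)⁻¹ := by
    rw [FrameTransport.localPiEquiv_frameConj]
    exact FrameTransport.coe_frameConjLocal F E c v (n + n) hJD (antidiagonal_over_eq_map F E n) Q hQ _
  have h := congrArg Units.val hGL
  simp only [Units.val_mul] at h
  rw [matS, h]
  rfl

omit [Algebra.IsQuadraticExtension F E] in
include hJD hDD hQm in
/-- **THE TRANSPORT IN THE ADAPTED FRAME IS CONJUGATION BY `diag(1, D)`**: for every `g′ ∈ U(J_{2n})(F_v)`,
`adapt (matA (Q g′ Q⁻¹)) = diag(1, D_v) · M′ · diag(1, Dinv_v)` where `M′ = reindex e₂⁻¹ (matS g′)` is the `Fin n ⊕ Fin n`-blocked matrix of `g′`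
(`Q = R · diag(1, D)` with `R = cayR`, and `adapt = R⁻¹ (·) R`). [cite: HarrisKudlaSweet1996, §1 (1.11)] [cite: PlatonovRapinchuk1994, §2.3] -/
theorem adapt_matA_frameConj (x' : UnitaryGroup.localPi E c (n + n) ((StdForm.antidiagonal (n + n)).over E) v) :
    adapt (matA F E c v n (FrameTransport.frameConj F E c v (n + n) hJD (antidiagonal_over_eq_map F E n) Q hQ x')) =
      Matrix.fromBlocks 1 0 0 (D.map ((UnitaryGroup.toLocalRing E v).comp (algebraMap F (v.adicCompletion F)))) *
        Matrix.reindex (e₂ n).symm (e₂ n).symm (matS F E c v n x') *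
        Matrix.fromBlocks 1 0 0 (Dinv.map ((UnitaryGroup.toLocalRing E v).comp (algebraMap F (v.adicCompletion F)))) := by
  set φ : F →+* UnitaryGroup.LocalRing E v := (UnitaryGroup.toLocalRing E v).comp (algebraMap F (v.adicCompletion F)) with hφ
  have hA : Matrix.reindex (e₂ n).symm (e₂ n).symm ((Q : Matrix (Fin (n + n)) (Fin (n + n)) F).map φ) =
      cayR (UnitaryGroup.LocalRing E v) (Fin n) * Matrix.fromBlocks 1 0 0 (D.map φ) := by
    rw [hQm, Matrix.reindex_apply, Matrix.reindex_apply, ← Matrix.submatrix_map, Matrix.submatrix_submatrix, Equiv.self_comp_symm,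
      Matrix.submatrix_id_id, Matrix.fromBlocks_map, Matrix.map_one _ (map_zero φ) (map_one φ), Matrix.map_neg _ (map_neg φ), frame_eq_cayR_mul']
  have hBA : Matrix.reindex (e₂ n).symm (e₂ n).symm (((Q⁻¹ : GL (Fin (n + n)) F) : Matrix (Fin (n + n)) (Fin (n + n)) F).map φ) *
      (cayR (UnitaryGroup.LocalRing E v) (Fin n) * Matrix.fromBlocks 1 0 0 (D.map φ)) = 1 := by
    rw [← hA, reindex_mul_reindex, ← Matrix.map_mul, ← Units.val_mul, inv_mul_cancel, Units.val_one, Matrix.map_one _ (map_zero φ) (map_one φ),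
      Matrix.reindex_apply, Matrix.submatrix_one_equiv]
  -- `diag(1, D_v) · diag(1, Dinv_v) = 1`
  have hdiag : Matrix.fromBlocks (1 : Matrix (Fin n) (Fin n) (UnitaryGroup.LocalRing E v)) 0 0 (D.map φ) * Matrix.fromBlocks 1 0 0 (Dinv.map φ) = 1 := by
    rw [Matrix.fromBlocks_multiply, ← Matrix.map_mul, hDD, Matrix.map_one _ (map_zero φ) (map_one φ), ← Matrix.fromBlocks_one]
    simp
  -- `B · R = diag(1, Dinv_v)` for `B = reindex (Q⁻¹ ⊗ 1)`
  have hBR : Matrix.reindex (e₂ n).symm (e₂ n).symm (((Q⁻¹ : GL (Fin (n + n)) F) : Matrix (Fin (n + n)) (Fin (n + n)) F).map φ) *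
      cayR (UnitaryGroup.LocalRing E v) (Fin n) = Matrix.fromBlocks 1 0 0 (Dinv.map φ) := by
    have h1 := congrArg (fun M => M * Matrix.fromBlocks (1 : Matrix (Fin n) (Fin n) (UnitaryGroup.LocalRing E v)) 0 0 (Dinv.map φ)) hBA
    simp only [Matrix.mul_assoc, Matrix.one_mul] at h1
    rw [hdiag, Matrix.mul_one] at h1
    exact h1
  rw [matA, matS_frameConj F E c v n hJD Q hQ x', ← reindex_mul_reindex, ← reindex_mul_reindex, hA, adapt]
  calc cayRinv (UnitaryGroup.LocalRing E v) (Fin n) *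
        (cayR (UnitaryGroup.LocalRing E v) (Fin n) * Matrix.fromBlocks 1 0 0 (D.map φ) * Matrix.reindex (e₂ n).symm (e₂ n).symm (matS F E c v n x') *
          Matrix.reindex (e₂ n).symm (e₂ n).symm (((Q⁻¹ : GL (Fin (n + n)) F) : Matrix (Fin (n + n)) (Fin (n + n)) F).map φ)) *
        cayR (UnitaryGroup.LocalRing E v) (Fin n)
      = (cayRinv (UnitaryGroup.LocalRing E v) (Fin n) * cayR (UnitaryGroup.LocalRing E v) (Fin n)) * Matrix.fromBlocks 1 0 0 (D.map φ) *
          Matrix.reindex (e₂ n).symm (e₂ n).symm (matS F E c v n x') *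
          (Matrix.reindex (e₂ n).symm (e₂ n).symm (((Q⁻¹ : GL (Fin (n + n)) F) : Matrix (Fin (n + n)) (Fin (n + n)) F).map φ) *
            cayR (UnitaryGroup.LocalRing E v) (Fin n)) := by simp only [Matrix.mul_assoc]
    _ = _ := by rw [cayRinv_mul_cayR, Matrix.one_mul, hBR]

end Generic

/-! ## §2 `n = 2`: B1a's abstract `U(J₄)(E ⊗ F_v, conjLocal)` IS the factor-form `U(J₄)(F_v)` -/

omit [Algebra.IsQuadraticExtension F E] in
/-- the local form of `U(J₄)` at `v` is `J₄` over `E ⊗ F_v` (index types `Fin (2+2)` on the tree side, `Fin 4` on B1a's side — definitionally equal).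
[cite: Mok2014, §1 Notation p. 5] -/
theorem localForm_antidiagonal_two_two :
    (UnitaryGroup.adelicForm E (2 + 2) ((StdForm.antidiagonal (2 + 2)).over E)).map (UnitaryGroup.adeleToLocal E v) =
      (StdForm.antidiagonal 4).over (UnitaryGroup.LocalRing E v) := by
  rw [UnitaryGroup.localForm_eq_map E (2 + 2) v ((StdForm.antidiagonal (2 + 2)).over F) (StdForm.over_map _ _).symm, StdForm.over_map, StdForm.over_map]

/-- **`toLocalFour' : U(J₄)(E ⊗ F_v, conjLocal) ≃ₜ* U(J₄)(F_v)` on the MATRIX form ★ `UnitaryGroup.«local»`** (the identity on matrices: ★ `unitaryGroupOfFormCongrOfEq` at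
`T = 1` along `localForm_antidiagonal_two_two`). [cite: Mok2014, §1 Notation p. 5] [cite: PlatonovRapinchuk1994, §5.1] -/
def toLocalFour' : unitaryGroupOfForm (UnitaryGroup.conjLocal E c v) ((StdForm.antidiagonal 4).over (UnitaryGroup.LocalRing E v)) ≃ₜ*
    UnitaryGroup.«local» E c (2 + 2) ((StdForm.antidiagonal (2 + 2)).over E) v :=
  unitaryGroupOfFormCongrOfEq (UnitaryGroup.conjLocal E c v) 1
    ((UnitaryGroup.adelicForm E (2 + 2) ((StdForm.antidiagonal (2 + 2)).over E)).map (UnitaryGroup.adeleToLocal E v))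
    ((StdForm.antidiagonal 4).over (UnitaryGroup.LocalRing E v))
    (by rw [formCongr, Units.val_one, Matrix.map_one _ (map_zero _) (map_one _), Matrix.transpose_one, Matrix.one_mul, Matrix.mul_one,
      localForm_antidiagonal_two_two])

omit [Algebra.IsQuadraticExtension F E] in
/-- matrix of `toLocalFour' g`: `1 · g · 1⁻¹`. [cite: Mok2014, §1 Notation p. 5] -/
theorem coe_toLocalFour' (g : unitaryGroupOfForm (UnitaryGroup.conjLocal E c v) ((StdForm.antidiagonal 4).over (UnitaryGroup.LocalRing E v))) :
    ((toLocalFour' F E c v g : UnitaryGroup.«local» E c (2 + 2) ((StdForm.antidiagonal (2 + 2)).over E) v) :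
        GL (Fin (2 + 2)) (UnitaryGroup.LocalRing E v)) =
      (1 : GL (Fin (2 + 2)) (UnitaryGroup.LocalRing E v)) * (g : GL (Fin 4) (UnitaryGroup.LocalRing E v)) * (1 : GL (Fin (2 + 2)) (UnitaryGroup.LocalRing E v))⁻¹ :=
  rfl

/-- **`toLocalFour : U(J₄)(E ⊗ F_v, conjLocal) ≃ₜ* U(J₄)(F_v)`** (B1a's carrier at `R := E ⊗ F_v`, `σ := c ⊗ 1`, onto the tree's FACTOR form ★ `localPi` at
`N = 2 + 2`): `toLocalFour'` followed by ★ `localPiEquiv⁻¹`. [cite: Mok2014, §1 Notation p. 5] [cite: PlatonovRapinchuk1994, §5.1] -/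
def toLocalFour : unitaryGroupOfForm (UnitaryGroup.conjLocal E c v) ((StdForm.antidiagonal 4).over (UnitaryGroup.LocalRing E v)) ≃ₜ*
    UnitaryGroup.localPi E c (2 + 2) ((StdForm.antidiagonal (2 + 2)).over E) v :=
  (toLocalFour' F E c v).trans (UnitaryGroup.localPiEquiv E c (2 + 2) ((StdForm.antidiagonal (2 + 2)).over E) v).symm

omit [Algebra.IsQuadraticExtension F E] in
/-- unfolding: `localPiEquiv (toLocalFour g) = toLocalFour' g`. [cite: Mok2014, §1 Notation p. 5] -/
theorem localPiEquiv_toLocalFour (g : unitaryGroupOfForm (UnitaryGroup.conjLocal E c v) ((StdForm.antidiagonal 4).over (UnitaryGroup.LocalRing E v))) :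
    UnitaryGroup.localPiEquiv E c (2 + 2) ((StdForm.antidiagonal (2 + 2)).over E) v (toLocalFour F E c v g) = toLocalFour' F E c v g :=
  (UnitaryGroup.localPiEquiv E c (2 + 2) ((StdForm.antidiagonal (2 + 2)).over E) v).apply_symm_apply _

omit [Algebra.IsQuadraticExtension F E] in
/-- **matrix of `toLocalFour g`** over `E ⊗ F_v` is the matrix of `g`. [cite: Mok2014, §1 Notation p. 5] -/
theorem matS_toLocalFour (g : unitaryGroupOfForm (UnitaryGroup.conjLocal E c v) ((StdForm.antidiagonal 4).over (UnitaryGroup.LocalRing E v))) :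
    matS F E c v 2 (toLocalFour F E c v g) = (g : GL (Fin 4) (UnitaryGroup.LocalRing E v)).1 := by
  rw [matS, localPiEquiv_toLocalFour, coe_toLocalFour', inv_one, mul_one, one_mul]

/-! ## §3 `n = 2`: the Siegel unipotent of `U(J₄)` is carried into `N_Δ(F_v)` -/

section Two

variable {T₂ : Matrix (Fin 2) (Fin 2) F} (hT₂ : T₂.IsSymm) {J₂D : Matrix (Fin (2 + 2)) (Fin (2 + 2)) E} (hJ₂D : J₂D = (gramD F 2 T₂).map (algebraMap F E))
  (D Dinv : Matrix (Fin 2) (Fin 2) F) (hDD : D * Dinv = 1) (Q : GL (Fin (2 + 2)) F)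
  (hQm : (Q : Matrix (Fin (2 + 2)) (Fin (2 + 2)) F) = Matrix.reindex (e₂ 2) (e₂ 2) (Matrix.fromBlocks 1 D 1 (-D)))
  (hQ : (Q : Matrix (Fin (2 + 2)) (Fin (2 + 2)) F)ᵀ * gramD F 2 T₂ * (Q : Matrix (Fin (2 + 2)) (Fin (2 + 2)) F) = (StdForm.antidiagonal (2 + 2)).over F)

omit [Algebra.IsQuadraticExtension F E] in
/-- the blocked matrix of `n(x,z,y)`: `reindex e₂⁻¹ (n(x,z,y)) = (1, X; 0, 1)`, `X = (z y; x −σz)`. [cite: HarrisKudlaSweet1996, §1 (1.11)] -/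
theorem reindex_nSiegelM (x z y : UnitaryGroup.LocalRing E v) :
    Matrix.reindex (e₂ 2).symm (e₂ 2).symm (nSiegelM (UnitaryGroup.LocalRing E v) (UnitaryGroup.conjLocal E c v) x z y) =
      Matrix.fromBlocks 1 !![z, y; x, -UnitaryGroup.conjLocal E c v z] 0 1 := by
  ext i j
  rcases i with i | i <;> rcases j with j | j <;> fin_cases i <;> fin_cases j <;> rfl

omit [Algebra.IsQuadraticExtension F E] in
/-- the blocked matrix of `w_Δ^{J} = w₂ w₁ w₂`: `reindex e₂⁻¹ = (0 1; 1 0)`. [cite: HarrisKudlaSweet1996, §1 (1.12)] -/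
theorem reindex_weylSiegel :
    Matrix.reindex (e₂ 2).symm (e₂ 2).symm
        ((weylSiegel (UnitaryGroup.LocalRing E v) (UnitaryGroup.conjLocal E c v) : unitaryGroupOfForm _ _) : GL (Fin 4) (UnitaryGroup.LocalRing E v)).1 =
      Matrix.fromBlocks 0 1 1 0 := by
  rw [coe_weylSiegel]
  ext i j
  rcases i with i | i <;> rcases j with j | j <;> fin_cases i <;> fin_cases j <;> rfl

omit [Algebra.IsQuadraticExtension F E] in
include hDD in
/-- `D_v · Dinv_v = 1` over `E ⊗ F_v`. [folklore] -/
theorem map_D_mul_map_Dinv :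
    D.map ((UnitaryGroup.toLocalRing E v).comp (algebraMap F (v.adicCompletion F))) *
        Dinv.map ((UnitaryGroup.toLocalRing E v).comp (algebraMap F (v.adicCompletion F))) = 1 := by
  rw [← Matrix.map_mul, hDD, Matrix.map_one _ (map_zero _) (map_one _)]

include hJ₂D hDD hQm in
/-- **the transported Siegel unipotent in the adapted frame**: `adapt (matA (Q n(x,z,y) Q⁻¹)) = (1, X·Dinv_v; 0, 1)`.
[cite: HarrisKudlaSweet1996, §1 (1.11)] -/
theorem adapt_matA_frameConj_nSiegel (x z y : UnitaryGroup.LocalRing E v) (hx : UnitaryGroup.conjLocal E c v x = -x) (hy : UnitaryGroup.conjLocal E c v y = -y) :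
    adapt (matA F E c v 2 (FrameTransport.frameConj F E c v (2 + 2) hJ₂D (antidiagonal_over_eq_map F E 2) Q hQ
        (toLocalFour F E c v (nSiegel (UnitaryGroup.LocalRing E v) (UnitaryGroup.conjLocal E c v) (UnitaryGroup.conjLocal_conjLocal c v hcδ hδ) x z y hx hy)))) =
      Matrix.fromBlocks 1 (!![z, y; x, -UnitaryGroup.conjLocal E c v z] * Dinv.map ((UnitaryGroup.toLocalRing E v).comp (algebraMap F (v.adicCompletion F)))) 0 1 := by
  rw [adapt_matA_frameConj F E c v 2 hJ₂D D Dinv hDD Q hQm hQ, matS_toLocalFour, coe_nSiegel, reindex_nSiegelM, Matrix.fromBlocks_multiply,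
    Matrix.fromBlocks_multiply]
  simp only [Matrix.mul_one, Matrix.one_mul, Matrix.mul_zero, Matrix.zero_mul, add_zero, zero_add, map_D_mul_map_Dinv F E v D Dinv hDD]

include hJ₂D hDD hQm in
/-- **`Q n(x,z,y) Q⁻¹ ∈ N_Δ(F_v)`**. [cite: HarrisKudlaSweet1996, §1 (1.11)] -/
theorem frameConj_nSiegel_mem_unipDeltaLocal (x z y : UnitaryGroup.LocalRing E v) (hx : UnitaryGroup.conjLocal E c v x = -x)
    (hy : UnitaryGroup.conjLocal E c v y = -y) :
    FrameTransport.frameConj F E c v (2 + 2) hJ₂D (antidiagonal_over_eq_map F E 2) Q hQ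
        (toLocalFour F E c v (nSiegel (UnitaryGroup.LocalRing E v) (UnitaryGroup.conjLocal E c v) (UnitaryGroup.conjLocal_conjLocal c v hcδ hδ) x z y hx hy)) ∈
      unipDeltaLocal F E c v 2 (JD := J₂D) :=
  ⟨_, adapt_matA_frameConj_nSiegel F E c hcδ hδ v hJ₂D D Dinv hDD Q hQm hQ x z y hx hy⟩

/-! ## §4 `n = 2`: the Weyl representatives differ by a rational Levi element on the right -/

omit [Algebra.IsQuadraticExtension F E] in
include hJ₂D hDD hQm in
/-- **the transported Siegel Weyl element in the adapted frame**: `adapt (matA (Q w_Δ^{J} Q⁻¹)) = (0, Dinv_v; D_v, 0)`. [cite: HarrisKudlaSweet1996, §1 (1.12)] -/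
theorem adapt_matA_frameConj_weylSiegel :
    adapt (matA F E c v 2 (FrameTransport.frameConj F E c v (2 + 2) hJ₂D (antidiagonal_over_eq_map F E 2) Q hQ
        (toLocalFour F E c v (weylSiegel (UnitaryGroup.LocalRing E v) (UnitaryGroup.conjLocal E c v))))) =
      Matrix.fromBlocks 0 (Dinv.map ((UnitaryGroup.toLocalRing E v).comp (algebraMap F (v.adicCompletion F))))
        (D.map ((UnitaryGroup.toLocalRing E v).comp (algebraMap F (v.adicCompletion F)))) 0 := by
  rw [adapt_matA_frameConj F E c v 2 hJ₂D D Dinv hDD Q hQm hQ, matS_toLocalFour, reindex_weylSiegel, Matrix.fromBlocks_multiply, Matrix.fromBlocks_multiply]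
  simp only [Matrix.mul_one, Matrix.one_mul, Matrix.mul_zero, Matrix.zero_mul, add_zero, zero_add]

omit [Algebra.IsQuadraticExtension F E] in
include hJ₂D hDD hQm in
/-- **`Q w_Δ^{J} Q⁻¹ = w_Δ · m₀` with `m₀` a LEVI element**: `adapt (matA (w_Δ · Q w_Δ^{J} Q⁻¹)) = diag(D_v, Dinv_v)` (★ `weylDelta` has adapted matrix `(0 1; 1 0)`
and `w_Δ² = 1`). [cite: HarrisKudlaSweet1996, §1 (1.12)] [cite: Casselman1980, §3] -/
theorem adapt_matA_weylDelta_mul_frameConj_weylSiegel :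
    adapt (matA F E c v 2 (weylDelta F E c v 2 hJ₂D (T₀ := T₂) *
        FrameTransport.frameConj F E c v (2 + 2) hJ₂D (antidiagonal_over_eq_map F E 2) Q hQ
          (toLocalFour F E c v (weylSiegel (UnitaryGroup.LocalRing E v) (UnitaryGroup.conjLocal E c v))))) =
      Matrix.fromBlocks (D.map ((UnitaryGroup.toLocalRing E v).comp (algebraMap F (v.adicCompletion F)))) 0 0
        (Dinv.map ((UnitaryGroup.toLocalRing E v).comp (algebraMap F (v.adicCompletion F)))) := by
  rw [← matA_mul, adapt_mul, adapt_matA_frameConj_weylSiegel F E c v hJ₂D D Dinv hDD Q hQm hQ, weylDelta, matA_ofAdapted, adapt]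
  calc cayRinv (UnitaryGroup.LocalRing E v) (Fin 2) *
          (cayR (UnitaryGroup.LocalRing E v) (Fin 2) * Matrix.fromBlocks 0 1 1 0 * cayRinv (UnitaryGroup.LocalRing E v) (Fin 2)) *
          cayR (UnitaryGroup.LocalRing E v) (Fin 2) *
        Matrix.fromBlocks 0 (Dinv.map ((UnitaryGroup.toLocalRing E v).comp (algebraMap F (v.adicCompletion F))))
          (D.map ((UnitaryGroup.toLocalRing E v).comp (algebraMap F (v.adicCompletion F)))) 0
      = (cayRinv (UnitaryGroup.LocalRing E v) (Fin 2) * cayR (UnitaryGroup.LocalRing E v) (Fin 2)) * Matrix.fromBlocks 0 1 1 0 *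
          (cayRinv (UnitaryGroup.LocalRing E v) (Fin 2) * cayR (UnitaryGroup.LocalRing E v) (Fin 2)) *
          Matrix.fromBlocks 0 (Dinv.map ((UnitaryGroup.toLocalRing E v).comp (algebraMap F (v.adicCompletion F))))
            (D.map ((UnitaryGroup.toLocalRing E v).comp (algebraMap F (v.adicCompletion F)))) 0 := by simp only [Matrix.mul_assoc]
    _ = _ := by
      rw [cayRinv_mul_cayR, Matrix.one_mul, Matrix.mul_one, Matrix.fromBlocks_multiply]
      simp only [Matrix.one_mul, Matrix.mul_zero, Matrix.zero_mul, add_zero, zero_add]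

include hJ₂D hDD hQm hcδ hδ hd hT₂ in
/-- **`m₀ := w_Δ · Q w_Δ^{J} Q⁻¹ ∈ P_Δ(F_v)`** (`C = 0`). [cite: HarrisKudlaSweet1996, §1 (1.12)] -/
theorem isSiegelDelta_weylDelta_mul_frameConj_weylSiegel :
    IsSiegelDelta F E c hcδ hδ hd v 2 hT₂ hJ₂D (weylDelta F E c v 2 hJ₂D (T₀ := T₂) *
        FrameTransport.frameConj F E c v (2 + 2) hJ₂D (antidiagonal_over_eq_map F E 2) Q hQ
          (toLocalFour F E c v (weylSiegel (UnitaryGroup.LocalRing E v) (UnitaryGroup.conjLocal E c v)))) := by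
  rw [isSiegelDelta_iff_blkC_eq_zero, show blkC _ = (adapt (matA F E c v 2 (weylDelta F E c v 2 hJ₂D (T₀ := T₂) *
        FrameTransport.frameConj F E c v (2 + 2) hJ₂D (antidiagonal_over_eq_map F E 2) Q hQ
          (toLocalFour F E c v (weylSiegel (UnitaryGroup.LocalRing E v) (UnitaryGroup.conjLocal E c v)))))).toBlocks₂₁ by rw [adapt_eq, Matrix.toBlocks_fromBlocks₂₁],
    adapt_matA_weylDelta_mul_frameConj_weylSiegel F E c v hJ₂D D Dinv hDD Q hQm hQ, Matrix.toBlocks_fromBlocks₂₁]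

omit [Algebra.IsQuadraticExtension F E] in
include hJ₂D hDD hQm in
/-- **… and is a LEVI element** (`B = 0`). [cite: HarrisKudlaSweet1996, §1 (1.12)] -/
theorem blkB_weylDelta_mul_frameConj_weylSiegel :
    blkB (matA F E c v 2 (weylDelta F E c v 2 hJ₂D (T₀ := T₂) *
        FrameTransport.frameConj F E c v (2 + 2) hJ₂D (antidiagonal_over_eq_map F E 2) Q hQ
          (toLocalFour F E c v (weylSiegel (UnitaryGroup.LocalRing E v) (UnitaryGroup.conjLocal E c v))))) = 0 := by
  rw [show blkB _ = (adapt (matA F E c v 2 (weylDelta F E c v 2 hJ₂D (T₀ := T₂) *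
        FrameTransport.frameConj F E c v (2 + 2) hJ₂D (antidiagonal_over_eq_map F E 2) Q hQ
          (toLocalFour F E c v (weylSiegel (UnitaryGroup.LocalRing E v) (UnitaryGroup.conjLocal E c v)))))).toBlocks₁₂ by rw [adapt_eq, Matrix.toBlocks_fromBlocks₁₂],
    adapt_matA_weylDelta_mul_frameConj_weylSiegel F E c v hJ₂D D Dinv hDD Q hQm hQ, Matrix.toBlocks_fromBlocks₁₂]

end Two

end Summit.HodgeConjecture.HodgeConjecture.Cruxes.HLiu418.K2LiuDoubledUTwoTwoFrameTransport

end
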